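import Summits.BirchSwinnertonDyer.Rank1Residual.ManinAdditive.TwistOrbitManinNearInvariance
import Summits.BirchSwinnertonDyer.BirchSwinnertonDyer.Theorems.AdditiveKolyvaginRoadManinFrameResidueProperRTameTwistFull57
import Literature.NumberTheory.EllipticCurves.OpenImageMazurAssemblyProofs
import HarnessLib

/-!
# Route `ManinLocalTwoThree`, residual crux C5 `ManinPrimeToAdditiveFiveLe` (stmt-BirchSwinnertonDyer-22969),
# line `upper_anchor` (skeleton v3): STUB 4 `stub_directionLawIrr` CLOSED MODULO {Kato F′, Kato F″, the
# Kosters–Pannekoek corner} — the direction law on irreducible commuting `p*`-pairs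

CONDITIONAL discharge (a `--supports` helper; the registered stub stays `sorry` in the skeleton, since C5
carries neither input). The reshaped stub 4 of the line (lead, v3, `Cruxes/ManinPrimeToAdditiveFiveLe/Lines/
upper_anchor.lean`): on a commuting optimal `p*`-pair `u • (W ⊗ χ_{p*}) = W'` at a common conductor with
`p ≥ 5`, `p² ∣ N`, both data lattice-optimal at conductor level and `W[p]` irreducible, «degree up ⇒
discriminant up» (`deg' = p·deg ⇒ v_pΔ'_min = v_pΔ_min + 6`).

HOW. By the cell's PROVED near-invariance (`pStar_optimal_commuting_manin_near_invariance`) the only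
competitor of the conclusion in the case `deg' = p·deg` is `v_p c' = v_p c + 1`, i.e. `p ∣ c'`; so the stub
follows from `p ∤ c` on the partner. Cell `pub/bsd-wall`'s tame-twist lever supplies exactly that on the
irreducible additive locus, GRANTED the statement-only Kato–Kim–Nakamura facts: F′
(`kato_neron_isIntegral_twistedSymbolSum_of_additive`, every `p > 7`; tree
`ManinFrameResidueProperRTameTwist.not_dvd_c_of_tameTwistL`) and F″ (`…_of_additive_five_le`, `p ∈ {5,7}`
off the Kosters–Pannekoek exception `W'(ℚ_p)[p] ≠ 0`; tree `…not_dvd_c_of_tameTwist57`); the exception is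
carried as the explicit core hypothesis (KP).
* §1 `maninLocalTwoThree_not_dvd_c_of_kato_of_irreducible` — conductor-level, modularity-free form of
  `…KatoReduction`'s §1: F′ → F″ → `p ∤ c` at a lattice-optimal conductor-level datum, `5 ≤ p`, `p² ∣ N(W)`,
  `E[p]` irreducible, and at `p ∈ {5,7}` no point of order `p` in `W(ℚ_p)`.
* §2 `directionLawIrr_of_kato_of_coreKP` — F′ → F″ → (KP) → the registered stub 4 signature VERBATIM.

HONEST SCOPE. Conditional on two unproved cite-only facts (derived readings of Kato 2004 + Kim–Nakamura 2020
⟸ Kosters–Pannekoek 2017, referee-flagged in their docstrings) and on the open core (KP) (= crux KP57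
stmt-BirchSwinnertonDyer-23810's territory); closes nothing; BSD is not proved by this; C5 is not proved by
this. Seat bsd-line-ml23-c5-p1 (lead).

References: [Kato2004Asterisque] (8.1.3), Thm. 9.7, Thm. 6.6 (1); [KimNakamura2020] Thm. 2.1, Cor. 2.4;
[KostersPannekoek2017] Thm. 1, Cor. 2; [KrausOesterle1992]; [EdixhovenManin1991] §4 (cases 1/2).
-/

set_option autoImplicit false
set_option linter.dupNamespace false

noncomputable section

open scoped Classical

namespace Summit.BirchSwinnertonDyer.BirchSwinnertonDyer.Theorems

open WeierstrassCurve IsDedekindDomain IsDedekindDomain.HeightOneSpectrum Rat.HeightOneSpectrum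
  Literature.NumberTheory.EllipticCurves Literature.NumberTheory.EllipticCurves.ModularForms
  Literature.NumberTheory.EllipticCurves.Rank1Residual
  Summit.BirchSwinnertonDyer.Rank1Residual.Additive
  Summit.BirchSwinnertonDyer.Rank1Residual.ManinAdditive

/-! ## §1 `p ∤ c` on the irreducible additive locus at conductor level, granted F′ and F″ -/

/-- **Manin's `p`-part at a lattice-optimal CONDUCTOR-LEVEL datum, `p ≥ 5` additive, `E[p]` irreducible,
GRANTED F′ (`p > 7`) and F″ (`p ∈ {5,7}`, then assuming no point of order `p` in `W(ℚ_p)`).** No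
modularity hypothesis is needed at conductor level: `a_ℓ = ±1` at `ℓ ∥ N(W)` is Kraus–Oesterlé, and the
tame-twist lever of cell `pub/bsd-wall` concludes. CONDITIONAL on F′, F″.
[cite: Kato2004Asterisque, (8.1.3) (p. 180), Thm. 9.7 (p. 189), Thm. 6.6 (1) (p. 163)]
[cite: KimNakamura2020, Thm. 2.1, Cor. 2.4] [cite: KostersPannekoek2017, Thm. 1 and Cor. 2] -/
theorem maninLocalTwoThree_not_dvd_c_of_kato_of_irreducible
    (hK : kato_neron_isIntegral_twistedSymbolSum_of_additive)
    (hK57 : kato_neron_isIntegral_twistedSymbolSum_of_additive_five_le)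
    (W : WeierstrassCurve ℚ) [W.IsElliptic] [W.IsGloballyMinimal] [NeZero (W.conductorNorm ℤ)]
    (D : ModularParametrizationData W (W.conductorNorm ℤ)) (hD : IsLatticeOptimal D)
    {p : ℕ} [Fact p.Prime] (h5 : 5 ≤ p) (hpN : p ^ 2 ∣ W.conductorNorm ℤ)
    (hirr : W.HasIrreducibleModPGaloisRep p)
    (hPT : p = 5 ∨ p = 7 → ∀ P : (W.baseChange ℚ_[p]).toAffine.Point, p • P = 0 → P = 0) :
    ¬ (p : ℤ) ∣ D.c := by
  have hp : p.Prime := Fact.out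
  have hadd : Addv W p := not_good_and_not_mult_of_sq_dvd_conductorNorm W hpN
  have ha : ∀ ℓ ∈ (W.conductorNorm ℤ).primeFactors, ¬ ℓ ^ 2 ∣ W.conductorNorm ℤ →
      W.LFunction ℓ = 1 ∨ W.LFunction ℓ = -1 := by
    intro ℓ hℓ hℓ2
    haveI : Fact ℓ.Prime := ⟨Nat.prime_of_mem_primeFactors hℓ⟩
    rcases hasGoodReductionAtPrime_or_hasMultiplicativeReductionAtPrime_of_not_sq_dvd_conductorNorm
      (V := W) hℓ2 with hg | hmul
    · exact absurd (Nat.dvd_of_mem_primeFactors hℓ) (not_dvd_conductorNorm_of_hasGoodReductionAtPrime W hg)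
    · exact KrausOesterle1992.lFunction_apply_prime_eq_one_or_eq_neg_one_of_mult W ℓ hmul
  by_cases h57 : p = 5 ∨ p = 7
  · exact ManinFrameResidueProperRTameTwist.not_dvd_c_of_tameTwist57 hK57 h57 W D hD (hPT h57) hadd
      hirr hpN ha
  · have h7 : 7 < p := by
      obtain ⟨hp5, hp7⟩ := not_or.mp h57
      have hp6 : p ≠ 6 := by rintro rfl; norm_num at hp
      omega
    exact ManinFrameResidueProperRTameTwist.not_dvd_c_of_tameTwistL hK W D hD h7 hadd hirr hpN ha

/-! ## §2 Stub 4 (v3) `stub_directionLawIrr`, granted F′, F″ and the Kosters–Pannekoek core -/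

/-- **STUB 4 `stub_directionLawIrr` of line `upper_anchor` (v3; registered signature VERBATIM as the
conclusion), GRANTED F′, F″ and the Kosters–Pannekoek core (KP)** — (KP): at `p ∈ {5,7}`, a globally
minimal curve additive at `p` (`p² ∣ N`) with `E[p]` irreducible and a `ℚ_p`-rational point of order `p`
has `p ∤ c` at every lattice-optimal conductor-level datum (open; the Kummer corner of crux KP57). Proof:
the partner `W'` is additive (`N(W') = N(W)`), has `W'[p]` irreducible (twist + change of variables), so
`p ∤ c(D')` by §1 or (KP); then the cell's near-invariance leaves only `v_pΔ' = v_pΔ + 6` in the case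
`deg' = p·deg`. CONDITIONAL; the stub stays `sorry` in the skeleton.
[cite: Kato2004Asterisque, (8.1.3) (p. 180), Thm. 9.7 (p. 189)] [cite: KimNakamura2020, Cor. 2.4]
[cite: EdixhovenManin1991, §4 (pp. 12–13)] -/
theorem directionLawIrr_of_kato_of_coreKP
    (hK : kato_neron_isIntegral_twistedSymbolSum_of_additive)
    (hK57 : kato_neron_isIntegral_twistedSymbolSum_of_additive_five_le)
    (hKP : ∀ (V : WeierstrassCurve ℚ) [V.IsElliptic] [V.IsGloballyMinimal] [NeZero (V.conductorNorm ℤ)]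
      (DV : ModularParametrizationData V (V.conductorNorm ℤ)), IsLatticeOptimal DV →
      ∀ (p : ℕ) [Fact p.Prime], (p = 5 ∨ p = 7) → p ^ 2 ∣ V.conductorNorm ℤ →
      V.HasIrreducibleModPGaloisRep p →
      (∃ P : (V.baseChange ℚ_[p]).toAffine.Point, p • P = 0 ∧ P ≠ 0) → ¬ (p : ℤ) ∣ DV.c) :
    ∀ {p : ℕ}, p.Prime → 5 ≤ p →
    ∀ (W W' : WeierstrassCurve ℚ) [W.IsElliptic] [W.IsGloballyMinimal] [W'.IsElliptic]
      [W'.IsGloballyMinimal] [NeZero (W.conductorNorm ℤ)] [NeZero (W'.conductorNorm ℤ)]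
      (u : VariableChange ℚ) (D : ModularParametrizationData W (W.conductorNorm ℤ))
      (D' : ModularParametrizationData W' (W'.conductorNorm ℤ)),
      IsLatticeOptimal D → IsLatticeOptimal D' →
      p ^ 2 ∣ W.conductorNorm ℤ → W'.conductorNorm ℤ = W.conductorNorm ℤ →
      u • W.quadraticTwist ((((-1 : ℤ) ^ (p / 2) * p : ℤ)) : ℚ) = W' →
      W.HasIrreducibleModPGaloisRep p →
      D'.modularDegree = p * D.modularDegree →
      padicValInt p W'.minimalDiscriminantInt = padicValInt p W.minimalDiscriminantInt + 6 := by
  intro p hp h5 W W' _ _ _ _ _ _ u D D' hD hD' hpN hNN hu hirr hdeg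
  haveI hpF : Fact p.Prime := ⟨hp⟩
  have hp2 : p ≠ 2 := by omega
  -- `p ∤ c` at every lattice-optimal conductor-level datum on the irreducible additive locus (§1 or (KP))
  have key : ∀ (V : WeierstrassCurve ℚ) [V.IsElliptic] [V.IsGloballyMinimal] [NeZero (V.conductorNorm ℤ)]
      (DV : ModularParametrizationData V (V.conductorNorm ℤ)), IsLatticeOptimal DV →
      p ^ 2 ∣ V.conductorNorm ℤ → V.HasIrreducibleModPGaloisRep p → ¬ (p : ℤ) ∣ DV.c := by
    intro V _ _ _ DV hDV hpV hirrV
    by_cases hT : ∃ P : (V.baseChange ℚ_[p]).toAffine.Point, p • P = 0 ∧ P ≠ 0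
    · by_cases h57 : p = 5 ∨ p = 7
      · exact hKP V DV hDV p h57 hpV hirrV hT
      · exact maninLocalTwoThree_not_dvd_c_of_kato_of_irreducible hK hK57 V DV hDV h5 hpV hirrV
          (fun h ↦ absurd h h57)
    · push Not at hT
      exact maninLocalTwoThree_not_dvd_c_of_kato_of_irreducible hK hK57 V DV hDV h5 hpV hirrV
        (fun _ P hP ↦ hT P hP)
  -- the partner is additive at `p` with `W'[p]` irreducible
  have hd0 : ((((-1 : ℤ) ^ (p / 2) * p : ℤ)) : ℚ) ≠ 0 := by
    push_cast
    exact mul_ne_zero (pow_ne_zero _ (by norm_num)) (by exact_mod_cast hp.ne_zero)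
  haveI := W.isElliptic_quadraticTwist hd0
  have hirr' : W'.HasIrreducibleModPGaloisRep p := by
    rw [← hu]
    exact (Literature.NumberTheory.EllipticCurves.Mazur1978.hasIrreducibleModPGaloisRep_smul_iff
      _ u p).mpr (hasIrreducibleModPGaloisRep_quadraticTwist hirr hd0)
  have hpN' : p ^ 2 ∣ W'.conductorNorm ℤ := by rw [hNN]; exact hpN
  have hc' : ¬ (p : ℤ) ∣ D'.c := key W' D' hD' hpN' hirr'
  have h0' : padicValInt p D'.c = 0 := padicValInt.eq_zero_of_not_dvd hc'
  have hpos : 0 < D.modularDegree := D.deg_pos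
  rcases pStar_optimal_commuting_manin_near_invariance hp hp2 W W' u D D' hD hD' hpN hNN hu with
    ⟨-, ⟨-, hΔ⟩ | ⟨hc, -⟩⟩ | ⟨hdeg', -⟩
  · exact hΔ
  · -- `v_p c' = v_p c + 1 ≥ 1` contradicts `p ∤ c'`
    omega
  · -- `p·deg' = deg` and `deg' = p·deg` force `p² = 1`
    exfalso
    have h1 : p * (p * D.modularDegree) = 1 * D.modularDegree := by rw [← hdeg, hdeg', one_mul]
    have h2 : p * p = 1 := Nat.eq_of_mul_eq_mul_right hpos (by rw [← mul_assoc] at h1; exact h1)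
    exact hp.one_lt.ne' (Nat.eq_one_of_mul_eq_one_right h2)

end Summit.BirchSwinnertonDyer.BirchSwinnertonDyer.Theorems

end
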